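import Summits.ResolutionOfSingularities.ResolutionOfSingularities.Theorems.FrobeniusClosingPatchingRelPerfectTwoPlanesPlane
import HarnessLib

/-!
# Crux `PatchingRelPerfect` (stmt-ResolutionOfSingularities-16161), chain w52 — the rank-two member
# `f = x₀x₁ + x₂³`: the image of the REPAIRED companion on the chart `B₂`

[OURS · L1 W5.2 · rung, ideal bookkeeping for the repaired companion (design note NEXT-two-planes-cube.md,
Addenda 9–10; kit j286610)] With the point avatar `J_q = (x₀) + (x₁,x₂)(x₁,x₂,x₃) + (x₃³)`:
on `B₂` (`u = x₂`, `e₂ = 1`) `J_q B₂ = (u)·(e₀, u)` and hence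
`(𝔪ᴺ · A · J_q · A₃ · A₄ · I) B₂ = (u^{N+9}) · ((J₂ · (u,e₀)) · (u,e₀))` — exactly the shape consumed by
`…TwoPlanesPlaneJq.isRegular_of_isBlowup_tpPlane_coreJq_two`.

* `map_chartBase_tpJq_two` — `J_q B₂ = (u)·(e₀, u)`;
* `tp_allJq_product`, `map_tpAllJq_two` — the full image.

Nothing here is a statement of the manuscript under review.

## References

* The Stacks Project, Tag 080B. [StacksProject]
-/

-- `Summit.<Summit>.<Sub>.Theorems` with `Sub = Summit` (single-conjunct summit, D-0017)
set_option linter.dupNamespace false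

noncomputable section

open CategoryTheory CategoryTheory.Limits AlgebraicGeometry Literature.AlgebraicGeometry.Resolution
open IsLocalRing

namespace Summit.ResolutionOfSingularities.ResolutionOfSingularities.Theorems

namespace TwoPlanesRung

open ConeRung

universe u

/-- Reordering the six twisted factors of the repaired companion on `B₂`. [folklore] -/
theorem tp_allJq_product {B : Type*} [CommRing B] (W P X1 X2 X3 : Ideal B) (N : ℕ) :
    W ^ N * (W ^ 2 * P) * (W * P) * (W ^ 2 * X1) * (W ^ 2 * X2) * (W ^ 2 * X3) =
      W ^ (N + 9) * (X1 * X2 * X3 * P * P) := by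
  ring

section ChartTwoJq

variable {S : Type u} [CommRing S] (x : Fin 4 → S)

local notation3 (prettyPrint := false) "M" => Ideal.span (Set.range x)
local notation3 (prettyPrint := false) "fT" => x 0 * x 1 + x 2 ^ 3
local notation3 (prettyPrint := false) "φ" => chartBase x 2
local notation3 (prettyPrint := false) "uB" => chartBase x 2 (x 2)
local notation3 (prettyPrint := false) "e[" j "]" => chartGen x 2 j
local notation3 (prettyPrint := false) "U" => Ideal.span {chartBase x 2 (x 2)}
local notation3 (prettyPrint := false) "II" => Ideal.span (Set.range
  (Fin.cons (chartBase x 2 (x 2)) (fun _ : Fin 1 => chartGen x 2 0) : Fin 2 → chartRing x 2))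
local notation3 (prettyPrint := false) "J" => Ideal.span {chartGen x 2 0 * chartGen x 2 1, chartBase x 2 (x 2)} *
    (Ideal.span {chartGen x 2 0 * chartGen x 2 1 + chartBase x 2 (x 2) * chartGen x 2 2 ^ 3} ⊔
      Ideal.span {chartBase x 2 (x 2)} * Ideal.span {chartGen x 2 0} ⊔ Ideal.span {chartBase x 2 (x 2)} ^ 2) *
    (Ideal.span {chartGen x 2 0 * chartGen x 2 1 + chartBase x 2 (x 2) * chartGen x 2 2 ^ 3} ⊔
      Ideal.span {chartBase x 2 (x 2)} ^ 2)
local notation3 (prettyPrint := false) "tpJq" => Ideal.span {x 0} ⊔ Ideal.span {x 1, x 2} * Ideal.span {x 1, x 2, x 3} ⊔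
  Ideal.span {x 3 ^ 3}

/-- **`J_q B₂ = (u) · (e₀, u)`** (`x₀ ↦ u e₀`; `(x₁,x₂)(x₁,x₂,x₃) ↦ u²·⊤` since `e₂ = 1`; `x₃³ ↦ u³e₃³`).
[cite: StacksProject, Tag 080B] -/
theorem map_chartBase_tpJq_two : (tpJq).map φ = U * Ideal.span {e[0], uB} := by
  have hu : uB ∈ U := Ideal.mem_span_singleton_self _
  have hP : (Ideal.span {x 1, x 2}).map φ = U := by
    rw [Ideal.map_span, Set.image_insert_eq, Set.image_singleton, reesChartBase_apply_eq_mul_chartGen x 2 1,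
      Ideal.span_insert]
    exact sup_eq_right.mpr ((Ideal.span_singleton_le_iff_mem _).mpr (Ideal.mul_mem_right _ _ hu))
  have hT : (Ideal.span {x 1, x 2, x 3}).map φ = U := by
    rw [Ideal.map_span, Set.image_insert_eq, Set.image_insert_eq, Set.image_singleton,
      reesChartBase_apply_eq_mul_chartGen x 2 1, reesChartBase_apply_eq_mul_chartGen x 2 3,
      Ideal.span_insert, Ideal.span_insert]
    exact le_antisymm
      (sup_le ((Ideal.span_singleton_le_iff_mem _).mpr (Ideal.mul_mem_right _ _ hu))
        (sup_le le_rfl ((Ideal.span_singleton_le_iff_mem _).mpr (Ideal.mul_mem_right _ _ hu))))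
      (le_sup_of_le_right le_sup_left)
  have h3 : (Ideal.span {x 3 ^ 3}).map φ ≤ U ^ 2 := by
    rw [Ideal.map_span, Set.image_singleton, map_pow, reesChartBase_apply_eq_mul_chartGen x 2 3,
      Ideal.span_singleton_le_iff_mem]
    exact Ideal.pow_le_pow_right (by norm_num) (Ideal.pow_mem_pow (Ideal.mul_mem_right _ _ hu) 3)
  rw [Ideal.map_sup, Ideal.map_sup, Ideal.map_mul, map_chartBase_span_x0, hP, hT, ← pow_two,
    sup_eq_left.mpr (h3.trans le_sup_right), pow_two, ← Ideal.mul_sup, ← Ideal.span_insert]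

/-- **`𝔪ᴺ · A · J_q · A₃ · A₄ · I ↦ (u^{N+9}) · ((J₂ · (u,e₀)) · (u,e₀))`** on `B₂`.
[cite: StacksProject, Tag 080B] -/
theorem map_tpAllJq_two (N : ℕ) :
    (M ^ N * (Ideal.span {fT} ⊔ Ideal.span {x 0} * M ⊔ M ^ 3) * tpJq * (Ideal.span {fT} ⊔ M ^ 3) *
        (Ideal.span {fT} ⊔ Ideal.span {x 0} * M ^ 2 ⊔ M ^ 4) * (Ideal.span {fT} ⊔ M ^ 4)).map φ =
      Ideal.span {uB ^ (N + 9)} * ((J * II) * II) := by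
  rw [Ideal.map_mul, Ideal.map_mul, Ideal.map_mul, Ideal.map_mul, Ideal.map_mul, Ideal.map_pow,
    ConeRung.map_chartBase_M, map_chartBase_tpA, map_chartBase_tpJq_two, map_chartBase_tpA3,
    map_chartBase_tpA4, map_chartBase_tpI, span_range_plane, ← Ideal.span_singleton_pow]
  exact tp_allJq_product U (Ideal.span {e[0], uB}) _ _ _ N

end ChartTwoJq

end TwoPlanesRung

end Summit.ResolutionOfSingularities.ResolutionOfSingularities.Theorems

end
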